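import Mathlib
import HarnessLib
import Summits.AnomalousDissipation.AnomalousDissipation.Theses.LimitingAbsorption
import Summits.AnomalousDissipation.AnomalousDissipation.Theorems.LimitingAbsorptionKinematicSteadySourceLawToolkit
import Summits.AnomalousDissipation.AnomalousDissipation.Theorems.LimitingAbsorptionRelaxationBoundsInventoryShift

/-!
# `(U_h)` for one weak solution is `(U_h)` for all — line `Sketch`, crux
# `LimitingAbsorption.UniformRelaxationWitness` (stmt-AnomalousDissipation-2937)

Glue of the reshaped skeleton (v3) of line `Sketch`: the relaxation clause `(U_h)` of the crux
quantifies over EVERY weak solution (class `L^∞_t L²_x`, `Torus.IsWeakScalarTransportOn`) released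
with datum `h` from each phase. For `κ > 0` and a drift essentially bounded on every
`(0,T) × T²` — the crux's local-boundedness clause — weak solutions with the same datum agree for
a.e. `t` (in-tree bounded-drift uniqueness `KinematicSteadySourceLaw.ae_eq_of_memLp_top`, from the
pointwise energy inequality `IsWeakScalarTransportOn.lintegral_sq_add_le_holds`), so it suffices
to exhibit ONE weak solution per (phase, horizon) with the exponential bound. This moves the
uniqueness theorem out of the line's open stub into proved glue.
-/

open MeasureTheory Set Filter
open scoped ENNReal

noncomputable section

set_option linter.dupNamespace false

namespace Summit.AnomalousDissipation.AnomalousDissipation.Theorems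

open Literature.Analysis.FluidPDE Literature.Analysis.FunctionSpaces

/-- **`(U_h)` for one weak solution is `(U_h)` for all (bounded drift).** For `κ > 0` and a drift
`u` essentially bounded on every `(0,T) × T²`, if from every release phase `s ∈ S ⊆ [0, ∞)` and on
every horizon `T > 0` SOME weak solution released with datum `h` obeys the exponential bound
`‖θ(t)‖² ≤ C e^{-γ t} ‖h‖²` for a.e. `t ∈ (0,T)`, then EVERY weak solution does: weak solutions in
`L^∞_t L²_x` with bounded drift are unique for a.e. `t` (`KinematicSteadySourceLaw.ae_eq_of_memLp_top`,
from the pointwise energy inequality), and `scalarL2Sq` only sees the a.e. class of a slice. -/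
theorem relaxation_allSolutions_of_oneSolution :
    ∀ (κ : ℝ) (u : ℝ → UnitAddTorus (Fin 2) → EuclideanSpace ℝ (Fin 2)) (h : UnitAddTorus (Fin 2) → ℝ)
      (C γ : ℝ) (S : Set ℝ), 0 < κ → S ⊆ Set.Ici 0 →
      (∀ T : ℝ, 0 < T → MeasureTheory.MemLp (Literature.Analysis.FunctionSpaces.Torus.stLift u) ⊤
        (MeasureTheory.volume.restrict (Set.Ioo (0 : ℝ) T ×ˢ Set.univ))) →
      (∀ s ∈ S, ∀ T : ℝ, 0 < T → ∃ θ : ℝ → UnitAddTorus (Fin 2) → ℝ,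
        Literature.Analysis.FluidPDE.Torus.IsWeakScalarTransportOn T κ (fun t => u (s + t)) h θ ∧
          ∀ᵐ t ∂(MeasureTheory.volume.restrict (Set.Ioo (0 : ℝ) T)),
            Literature.Analysis.FluidPDE.Torus.scalarL2Sq (θ t) ≤
              C * Real.exp (-(γ * t)) * Literature.Analysis.FluidPDE.Torus.scalarL2Sq h) →
      ∀ s ∈ S, ∀ (T : ℝ) (θ : ℝ → UnitAddTorus (Fin 2) → ℝ),
        Literature.Analysis.FluidPDE.Torus.IsWeakScalarTransportOn T κ (fun t => u (s + t)) h θ →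
          ∀ᵐ t ∂(MeasureTheory.volume.restrict (Set.Ioo (0 : ℝ) T)),
            Literature.Analysis.FluidPDE.Torus.scalarL2Sq (θ t) ≤
              C * Real.exp (-(γ * t)) * Literature.Analysis.FluidPDE.Torus.scalarL2Sq h := by
  intro κ u h C γ S hκ hS hbd hOne s hs T θ hθ
  rcases le_or_gt T 0 with hT | hT
  · -- empty horizon: `(0,T) = ∅`
    rw [Set.Ioo_eq_empty (not_lt.2 hT), Measure.restrict_empty]
    rw [Filter.Eventually, MeasureTheory.ae_zero]; exact Filter.mem_bot
  obtain ⟨θ₁, hθ₁, hdec⟩ := hOne s hs T hT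
  have hs0 : 0 ≤ s := hS hs
  -- the shifted drift is essentially bounded on `(0,T) × T²`
  have hu : MemLp (Torus.stLift (fun t => u (s + t))) ⊤
      (volume.restrict (Ioo (0 : ℝ) T ×ˢ univ)) := by
    have := LapInventory.memLp_top_stLift_comp_const_add (a := s) (T := s + T) hs0
      (hbd (s + T) (by linarith))
    simpa [add_sub_cancel_left] using this
  have hae := KinematicSteadySourceLaw.ae_eq_of_memLp_top hκ hθ hθ₁ hu
  filter_upwards [hae, hdec] with t ht hbound
  have : Torus.scalarL2Sq (θ t) = Torus.scalarL2Sq (θ₁ t) := by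
    unfold Torus.scalarL2Sq
    exact integral_congr_ae (ht.mono fun x hx => by simp [hx])
  rw [this]
  exact hbound

end Summit.AnomalousDissipation.AnomalousDissipation.Theorems

end
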